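import Literature.Analysis.FunctionSpaces.BesovFatou
import Literature.Analysis.FunctionSpaces.LittlewoodPaleyDifferenceProofs
import Literature.Analysis.FunctionSpaces.LittlewoodPaleyHeatContinuity
import HarnessLib

/-!
# Littlewood–Paley partial sums converge in `Ḃ^s_{p,q}` for `q < ∞`

Analysis/FunctionSpaces proof file (theorems only: no definition, no named fact). For a tempered
distribution `u` of finite homogeneous Besov norm `‖u‖_{Ḃ^s_{p,q}}` with **finite third index**
`0 < q < ∞` (any `s ∈ ℝ`, `1 ≤ p ≤ ∞`):

* `tendsto_eHomBesovNorm_sub_lowFreqCutoff_atTop` — **the high-frequency tail vanishes**: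
  `‖u - Ṡ_J u‖_{Ḃ^s_{p,q}} → 0` as `J → +∞`;
* `tendsto_eHomBesovNorm_lowFreqCutoff_atBot` — **the low-frequency tail vanishes**:
  `‖Ṡ_J u‖_{Ḃ^s_{p,q}} → 0` as `J → -∞`;

so `u` is the limit *in `Ḃ^s_{p,q}`-norm* of the finite sums of its blocks
`Ṡ_{J₂} u - Ṡ_{J₁} u = ∑_{J₁ < j ≤ J₂} Δ̇_j u` (Bahouri–Chemin–Danchin 2011, proof of Prop. 2.27 /
Lemma 2.73: for `r < ∞` the series `∑ Δ̇_j u` converges to `u` in `Ḃ^s_{p,r}`; false for `r = ∞`).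
Each finite sum of blocks of a realised `u ∈ Ḃ^s_{p,q}` is an `L^p ∩ L^∞` function, smooth with all
derivatives in `L^p` (Bernstein), which is the cheap substitute for the density of test functions in
`Ḃ^s_{p,q}` (`p, q < ∞`) used in the far-field step of the blow-up proofs of the critical Besov
regularity criteria (W. Wang, Z. Zhang, arXiv:1510.02589, §4 Step 1: "there exists a sequence
`v₃ⁿ ∈ C₀^∞` so that `‖v₃ⁿ - v₃‖_{L^ℓ Ḃ^{-1+3/p}_{p,q}} → 0`").

The blockwise bookkeeping: `Δ̇_j (u - Ṡ_J u) = 0` for `j ≤ J - 1` and `Δ̇_j Ṡ_J u = 0` for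
`j ≥ J + 2` (symbol supports), while all blocks of `Ṡ_J u` and `u - Ṡ_J u` are bounded by
`(1 + M₀)` times those of `u` (`‖Ṡ_J‖_{L^p → L^p} ≤ M₀`, `lowFreqOpNormBound`); dominated convergence in
`ℓ^q(ℤ)` (`tendsto_eLpNorm_count_mul_of_dominated`) finishes.

## References

* H. Bahouri, J.-Y. Chemin, R. Danchin, *Fourier Analysis and Nonlinear PDE* (2011), Prop. 2.27,
  Lemma 2.73, (2.4)–(2.5). [BahouriCheminDanchin2011]
* W. Wang, Z. Zhang, Sci. China Math. 60 (2017) 637–650 = arXiv:1510.02589, §4 Step 1.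
  [WangZhang2016]
-/

noncomputable section

open MeasureTheory TemperedDistribution Filter Set Function
open _root_.Topology
open scoped SchwartzMap ENNReal NNReal

namespace Literature.Analysis.FunctionSpaces

variable {E : Type*} [NormedAddCommGroup E] [InnerProductSpace ℝ E] [FiniteDimensional ℝ E]
  [MeasurableSpace E] [BorelSpace E] {F : Type*} [NormedAddCommGroup F] [NormedSpace ℂ F]

/-! ## Symbol identities: `Ṡ_J` is the identity on the frequencies of `Δ̇_j`, `j ≤ J - 1` -/

omit [FiniteDimensional ℝ E] [MeasurableSpace E] [BorelSpace E] in
/-- `χ(2^{-j}ξ) χ(2^{-J}ξ) = χ(2^{-j}ξ)` for `j + 1 ≤ J`: on the support `‖ξ‖ < 2^{j+1} ≤ 2^J` of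
the first factor the second equals `1`. [folklore] -/
theorem lowFreqSymbol_mul_lowFreqSymbol_of_le {j J : ℤ} (h : j + 1 ≤ J) :
    (lowFreqSymbol (E := E) j * lowFreqSymbol J) = lowFreqSymbol j := by
  funext ξ
  simp only [Pi.mul_apply]
  by_cases hξ : ‖ξ‖ ≤ (2 : ℝ) ^ J
  · rw [lowFreqSymbol_eq_one_of_norm_le hξ, mul_one]
  · have hge : (2 : ℝ) ^ (j + 1) ≤ ‖ξ‖ :=
      (zpow_le_zpow_right₀ one_le_two h).trans (not_le.1 hξ).le
    have h0 : lowFreqSymbol (E := E) j ξ = 0 := by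
      simp only [lowFreqSymbol]
      rw [dyadicCutoff_apply_of_two_le_norm, Complex.ofReal_zero]
      rw [norm_two_zpow_smul]
      calc (2 : ℝ) = (2 : ℝ) ^ (-j) * (2 : ℝ) ^ (j + 1) := by
            rw [← zpow_add₀ (two_ne_zero' ℝ), show -j + (j + 1) = 1 by ring, zpow_one]
        _ ≤ (2 : ℝ) ^ (-j) * ‖ξ‖ := mul_le_mul_of_nonneg_left hge (zpow_nonneg zero_le_two _)
    rw [h0, zero_mul]

omit [FiniteDimensional ℝ E] [MeasurableSpace E] [BorelSpace E] in
/-- `φ_j(ξ) χ(2^{-J}ξ) = φ_j(ξ)` for `j + 1 ≤ J` (`φ_j = χ(2^{-j}·) - χ(2^{1-j}·)`). [folklore] -/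
theorem dyadicSymbol_mul_lowFreqSymbol_of_le {j J : ℤ} (h : j + 1 ≤ J) :
    (dyadicSymbol (E := E) j * lowFreqSymbol J) = dyadicSymbol j := by
  rw [dyadicSymbol_eq_sub, sub_mul, lowFreqSymbol_mul_lowFreqSymbol_of_le h,
    lowFreqSymbol_mul_lowFreqSymbol_of_le (by omega)]

/-- **`Ṡ_j Ṡ_J = Ṡ_j` for `j + 1 ≤ J`.** [folklore] -/
theorem lowFreqCutoff_lowFreqCutoff_of_le {j J : ℤ} (h : j + 1 ≤ J) (u : 𝓢'(E, F)) :
    lowFreqCutoff j (lowFreqCutoff J u) = lowFreqCutoff j u := by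
  rw [lowFreqCutoff_apply, lowFreqCutoff_apply, lowFreqCutoff_apply,
    fourierMultiplierCLM_fourierMultiplierCLM_apply (hasTemperateGrowth_lowFreqSymbol J)
      (hasTemperateGrowth_lowFreqSymbol j), mul_comm, lowFreqSymbol_mul_lowFreqSymbol_of_le h]

/-- **`Δ̇_j Ṡ_J = Δ̇_j` for `j + 1 ≤ J`.** [folklore] -/
theorem lpBlock_lowFreqCutoff_of_le {j J : ℤ} (h : j + 1 ≤ J) (u : 𝓢'(E, F)) :
    lpBlock j (lowFreqCutoff J u) = lpBlock j u := by
  rw [lpBlock_apply, lowFreqCutoff_apply, lpBlock_apply,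
    fourierMultiplierCLM_fourierMultiplierCLM_apply (hasTemperateGrowth_lowFreqSymbol J)
      (hasTemperateGrowth_dyadicSymbol j), mul_comm, dyadicSymbol_mul_lowFreqSymbol_of_le h]

/-- The low blocks of the high-frequency tail vanish: `Δ̇_j (u - Ṡ_J u) = 0` for `j + 1 ≤ J`.
[folklore] -/
theorem lpBlock_sub_lowFreqCutoff_of_le {j J : ℤ} (h : j + 1 ≤ J) (u : 𝓢'(E, F)) :
    lpBlock j (u - lowFreqCutoff J u) = 0 := by
  rw [map_sub, lpBlock_lowFreqCutoff_of_le h, sub_self]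

/-- `Ṡ_J u` is realised whenever `u` is (indeed `Ṡ_j Ṡ_J u = Ṡ_j u` for `j ≤ J - 1`). [folklore] -/
theorem tendsto_lowFreqCutoff_lowFreqCutoff_atBot' {u : 𝓢'(E, F)}
    (hu : Tendsto (fun j => lowFreqCutoff j u) atBot (𝓝 0)) (J : ℤ) :
    Tendsto (fun j => lowFreqCutoff j (lowFreqCutoff J u)) atBot (𝓝 0) := by
  refine hu.congr' ?_
  filter_upwards [eventually_le_atBot (J - 1)] with j hj
  exact (lowFreqCutoff_lowFreqCutoff_of_le (by omega) u).symm

/-- `u - Ṡ_J u` is realised (`Ṡ_j` of it vanishes for `j ≤ J - 1`). [folklore] -/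
theorem tendsto_lowFreqCutoff_sub_lowFreqCutoff_atBot (u : 𝓢'(E, F)) (J : ℤ) :
    Tendsto (fun j => lowFreqCutoff j (u - lowFreqCutoff J u)) atBot (𝓝 0) := by
  refine tendsto_const_nhds.congr' ?_
  filter_upwards [eventually_le_atBot (J - 1)] with j hj
  rw [map_sub, lowFreqCutoff_lowFreqCutoff_of_le (by omega) u, sub_self]

/-! ## The blocks of the two tails are dominated by those of `u` -/

section Weights

variable [CompleteSpace F] (s : ℝ) (p : ℝ≥0∞) [Fact (1 ≤ p)]

/-- The weights of the low-frequency part: `2^{js} ‖Δ̇_j Ṡ_J u‖_{L^p} ≤ M₀ · 2^{js} ‖Δ̇_j u‖_{L^p}`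
for every `j`, and `= 0` for `j ≥ J + 2`. [folklore] -/
theorem lpBlockWeight_lowFreqCutoff_le (J : ℤ) (u : 𝓢'(E, F)) (j : ℤ) :
    lpBlockWeight s p (lowFreqCutoff J u) j ≤
      (if j ≤ J + 1 then lowFreqOpNormBound E else 0) * lpBlockWeight s p u j := by
  split_ifs with hj
  · simp only [lpBlockWeight]
    rw [lpBlock_lowFreqCutoff_comm, mul_left_comm]
    gcongr
    exact eLpNormDistrib_lowFreqCutoff_le J _
  · rw [zero_mul, lpBlockWeight, lpBlock_lowFreqCutoff_eq_zero (by omega) u, eLpNormDistrib_zero,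
      mul_zero]

/-- The weights of the high-frequency tail:
`2^{js} ‖Δ̇_j (u - Ṡ_J u)‖_{L^p} ≤ (1 + M₀) · 2^{js} ‖Δ̇_j u‖_{L^p}` for every `j`, and `= 0` for
`j ≤ J - 1`. [folklore] -/
theorem lpBlockWeight_sub_lowFreqCutoff_le (J : ℤ) (u : 𝓢'(E, F)) (j : ℤ) :
    lpBlockWeight s p (u - lowFreqCutoff J u) j ≤
      (if J ≤ j then 1 + lowFreqOpNormBound E else 0) * lpBlockWeight s p u j := by
  split_ifs with hj
  · simp only [lpBlockWeight]
    rw [map_sub, lpBlock_lowFreqCutoff_comm, mul_left_comm]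
    gcongr
    calc eLpNormDistrib p (lpBlock j u - lowFreqCutoff J (lpBlock j u))
        ≤ eLpNormDistrib p (lpBlock j u) + eLpNormDistrib p (lowFreqCutoff J (lpBlock j u)) :=
          eLpNormDistrib_sub_le _ _
      _ ≤ eLpNormDistrib p (lpBlock j u) + lowFreqOpNormBound E * eLpNormDistrib p (lpBlock j u) := by
          gcongr
          exact eLpNormDistrib_lowFreqCutoff_le J _
      _ = (1 + lowFreqOpNormBound E) * eLpNormDistrib p (lpBlock j u) := by ring
  · rw [zero_mul, lpBlockWeight, lpBlock_sub_lowFreqCutoff_of_le (by omega) u, eLpNormDistrib_zero,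
      mul_zero]

end Weights

/-! ## The two tails tend to zero in `Ḃ^s_{p,q}`, `q < ∞` -/

section Tails

variable [CompleteSpace F]

/-- **The high-frequency tail of the Littlewood–Paley decomposition vanishes in `Ḃ^s_{p,q}`,
`q < ∞`** (BCD, proof of Prop. 2.27 / Lemma 2.73): `‖u - Ṡ_J u‖_{Ḃ^s_{p,q}} → 0` as `J → +∞`
for every `u` with `‖u‖_{Ḃ^s_{p,q}} < ∞`, `0 < q < ∞` (the weights of `u - Ṡ_J u` are those of `u`
damped by `(1 + M₀) 𝟙_{j ≥ J} → 0`; dominated convergence in `ℓ^q`). [cite: BahouriCheminDanchin2011, Prop. 2.27] -/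
theorem tendsto_eHomBesovNorm_sub_lowFreqCutoff_atTop {s : ℝ} {p q : ℝ≥0∞} [Fact (1 ≤ p)]
    (hq₀ : q ≠ 0) (hq : q ≠ ⊤) {u : 𝓢'(E, F)} (hu : eHomBesovNorm s p q u < ⊤) :
    Tendsto (fun J : ℤ => eHomBesovNorm s p q (u - lowFreqCutoff J u)) atTop (𝓝 0) := by
  set m : ℤ → ℤ → ℝ≥0∞ := fun J j => if J ≤ j then 1 + lowFreqOpNormBound E else 0 with hm
  have hdom := tendsto_eLpNorm_count_mul_of_dominated (l := (atTop : Filter ℤ)) hq₀ hq hu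
    (m := m) (M := 1 + lowFreqOpNormBound E)
    (ENNReal.add_ne_top.2 ⟨ENNReal.one_ne_top, lowFreqOpNormBound_lt_top.ne⟩)
    (fun J j => by simp only [hm]; split_ifs <;> simp) (fun j => by
      refine tendsto_const_nhds.congr' ?_
      filter_upwards [eventually_gt_atTop j] with J hJ
      simp only [hm, if_neg (not_le.2 hJ)])
  refine tendsto_of_tendsto_of_tendsto_of_le_of_le tendsto_const_nhds hdom (fun J => bot_le)
    fun J => ?_
  unfold eHomBesovNorm
  refine eLpNorm_mono_enorm fun j => ?_
  simp only [enorm_eq_self]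
  exact lpBlockWeight_sub_lowFreqCutoff_le s p J u j

/-- **The low-frequency tail of the Littlewood–Paley decomposition vanishes in `Ḃ^s_{p,q}`,
`q < ∞`** (BCD, proof of Prop. 2.27 / Lemma 2.73): `‖Ṡ_J u‖_{Ḃ^s_{p,q}} → 0` as `J → -∞` for
every `u` with `‖u‖_{Ḃ^s_{p,q}} < ∞`, `0 < q < ∞` (the weights of `Ṡ_J u` are those of `u` damped
by `M₀ 𝟙_{j ≤ J+1} → 0`). [cite: BahouriCheminDanchin2011, Prop. 2.27] -/
theorem tendsto_eHomBesovNorm_lowFreqCutoff_atBot {s : ℝ} {p q : ℝ≥0∞} [Fact (1 ≤ p)]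
    (hq₀ : q ≠ 0) (hq : q ≠ ⊤) {u : 𝓢'(E, F)} (hu : eHomBesovNorm s p q u < ⊤) :
    Tendsto (fun J : ℤ => eHomBesovNorm s p q (lowFreqCutoff J u)) atBot (𝓝 0) := by
  set m : ℤ → ℤ → ℝ≥0∞ := fun J j => if j ≤ J + 1 then lowFreqOpNormBound E else 0 with hm
  have hdom := tendsto_eLpNorm_count_mul_of_dominated (l := (atBot : Filter ℤ)) hq₀ hq hu
    (m := m) (M := lowFreqOpNormBound E) lowFreqOpNormBound_lt_top.ne
    (fun J j => by simp only [hm]; split_ifs <;> simp) (fun j => by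
      refine tendsto_const_nhds.congr' ?_
      filter_upwards [eventually_lt_atBot (j - 1)] with J hJ
      simp only [hm, if_neg (show ¬ j ≤ J + 1 by omega)])
  refine tendsto_of_tendsto_of_tendsto_of_le_of_le tendsto_const_nhds hdom (fun J => bot_le)
    fun J => ?_
  unfold eHomBesovNorm
  refine eLpNorm_mono_enorm fun j => ?_
  simp only [enorm_eq_self]
  exact lpBlockWeight_lowFreqCutoff_le s p J u j

/-- The high-frequency tails are uniformly bounded: `‖u - Ṡ_J u‖_{Ḃ^s_{p,q}} ≤ (1 + M₀) ‖u‖_{Ḃ^s_{p,q}}`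
for every `J` and every `q`. [folklore] -/
theorem eHomBesovNorm_sub_lowFreqCutoff_le (s : ℝ) (p q : ℝ≥0∞) [Fact (1 ≤ p)] (J : ℤ)
    (u : 𝓢'(E, F)) :
    eHomBesovNorm s p q (u - lowFreqCutoff J u) ≤ (1 + lowFreqOpNormBound E) * eHomBesovNorm s p q u := by
  have hC0 : (1 + lowFreqOpNormBound E) ≠ 0 := by positivity
  have hC : (1 + lowFreqOpNormBound E) ≠ ⊤ :=
    ENNReal.add_ne_top.2 ⟨ENNReal.one_ne_top, lowFreqOpNormBound_lt_top.ne⟩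
  unfold eHomBesovNorm
  rw [← eLpNorm_const_mul_ennreal Measure.count q hC0 hC
    StronglyMeasurable.of_discrete.aestronglyMeasurable]
  refine eLpNorm_mono_enorm fun j => ?_
  simp only [enorm_eq_self]
  refine (lpBlockWeight_sub_lowFreqCutoff_le s p J u j).trans ?_
  gcongr
  split_ifs <;> simp

/-- The low-frequency parts are uniformly bounded: `‖Ṡ_J u‖_{Ḃ^s_{p,q}} ≤ M₀ ‖u‖_{Ḃ^s_{p,q}}` for
every `J` and every `q`. [folklore] -/
theorem eHomBesovNorm_lowFreqCutoff_le' (s : ℝ) (p q : ℝ≥0∞) [Fact (1 ≤ p)] (J : ℤ)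
    (u : 𝓢'(E, F)) :
    eHomBesovNorm s p q (lowFreqCutoff J u) ≤ lowFreqOpNormBound E * eHomBesovNorm s p q u := by
  have hC0 : lowFreqOpNormBound E ≠ 0 := (one_le_lowFreqOpNormBound.trans_lt' zero_lt_one).ne'
  have hC : lowFreqOpNormBound E ≠ ⊤ := lowFreqOpNormBound_lt_top.ne
  unfold eHomBesovNorm
  rw [← eLpNorm_const_mul_ennreal Measure.count q hC0 hC
    StronglyMeasurable.of_discrete.aestronglyMeasurable]
  refine eLpNorm_mono_enorm fun j => ?_
  simp only [enorm_eq_self]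
  refine (lpBlockWeight_lowFreqCutoff_le s p J u j).trans ?_
  gcongr
  split_ifs <;> simp

/-- **Every element of `Ḃ^s_{p,q}`, `q < ∞`, is approximated in norm by its middle frequencies**:
for `ε > 0` there are `J₁ ≤ J₂` with both tails `‖Ṡ_{J₁} u‖_{Ḃ^s_{p,q}} ≤ ε` and
`‖u - Ṡ_{J₂} u‖_{Ḃ^s_{p,q}} ≤ ε`; the middle part `Ṡ_{J₂} u - Ṡ_{J₁} u` is the finite sum of blocks
`∑_{J₁ < j ≤ J₂} Δ̇_j u` (`sum_Icc_lpBlock_eq`). [cite: BahouriCheminDanchin2011, Prop. 2.27] -/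
theorem exists_eHomBesovNorm_tails_le {s : ℝ} {p q : ℝ≥0∞} [Fact (1 ≤ p)] (hq₀ : q ≠ 0)
    (hq : q ≠ ⊤) {u : 𝓢'(E, F)} (hu : eHomBesovNorm s p q u < ⊤) {ε : ℝ≥0∞} (hε : 0 < ε) :
    ∃ J₁ J₂ : ℤ, J₁ ≤ J₂ ∧ eHomBesovNorm s p q (lowFreqCutoff J₁ u) ≤ ε ∧
      eHomBesovNorm s p q (u - lowFreqCutoff J₂ u) ≤ ε := by
  obtain ⟨J₁, hJ₁⟩ := ((ENNReal.tendsto_nhds_zero.1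
    (tendsto_eHomBesovNorm_lowFreqCutoff_atBot hq₀ hq hu)) ε hε).exists
  have h2 := (ENNReal.tendsto_nhds_zero.1 (tendsto_eHomBesovNorm_sub_lowFreqCutoff_atTop hq₀ hq hu))
    ε hε
  obtain ⟨J₂, hJ₂, hJ₁₂⟩ := (h2.and (eventually_ge_atTop J₁)).exists
  exact ⟨J₁, J₂, hJ₁₂, hJ₁, hJ₂⟩

end Tails

/-! ## Low frequencies of `Ḃ^s_{p,∞}`, `s < 0`, are `L^p` functions -/

section LowFreqLp

/-- Two-sided geometric sums over `ℤ`: `∑_{j ∈ ℤ} r^{|j|} = ∑_n r^n + ∑_n r^{n+1} ≤ 2 (1 - r)⁻¹`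
in `[0, ∞]`. [folklore] -/
theorem tsum_int_pow_natAbs_le (r : ℝ≥0∞) : ∑' j : ℤ, r ^ j.natAbs ≤ 2 * (1 - r)⁻¹ := by
  rcases le_or_gt 1 r with hr1 | hr1
  · -- `1 ≤ r`: the right-hand side is `∞`
    rw [tsub_eq_zero_of_le hr1, ENNReal.inv_zero, ENNReal.mul_top two_ne_zero]
    exact le_top
  rw [tsum_of_nat_of_neg_add_one (f := fun j : ℤ => r ^ j.natAbs) ENNReal.summable
    ENNReal.summable]
  have h1 : ∑' n : ℕ, r ^ (n : ℤ).natAbs = (1 - r)⁻¹ := by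
    simp only [Int.natAbs_natCast, ENNReal.tsum_geometric]
  have h2 : ∑' n : ℕ, r ^ (-((n : ℤ) + 1)).natAbs ≤ (1 - r)⁻¹ := by
    calc ∑' n : ℕ, r ^ (-((n : ℤ) + 1)).natAbs = ∑' n : ℕ, r ^ (n + 1) :=
          tsum_congr fun n => by rw [show (-((n : ℤ) + 1)).natAbs = n + 1 by omega]
      _ ≤ ∑' n : ℕ, r ^ n :=
          ENNReal.tsum_le_tsum fun n => pow_le_pow_of_le_one (by simp) hr1.le (Nat.le_succ n)
      _ = (1 - r)⁻¹ := ENNReal.tsum_geometric r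
  calc (∑' n : ℕ, r ^ (n : ℤ).natAbs) + ∑' n : ℕ, r ^ (-((n : ℤ) + 1)).natAbs
      ≤ (1 - r)⁻¹ + (1 - r)⁻¹ := add_le_add h1.le h2
    _ = 2 * (1 - r)⁻¹ := (two_mul _).symm

/-- Shifted two-sided geometric sums: `∑_{j ∈ ℤ} r^{|j - m|} ≤ 2 (1 - r)⁻¹`. [folklore] -/
theorem tsum_int_pow_natAbs_sub_le (r : ℝ≥0∞) (m : ℤ) :
    ∑' j : ℤ, r ^ (j - m).natAbs ≤ 2 * (1 - r)⁻¹ := by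
  rw [← (Equiv.addRight m).tsum_eq (fun j : ℤ => r ^ (j - m).natAbs)]
  simp only [Equiv.coe_addRight, add_sub_cancel_right]
  exact tsum_int_pow_natAbs_le r

variable [CompleteSpace F]

/-- **The low frequencies of an element of `Ḃ^s_{p,∞}`, `s < 0`, form an `L^p` function, with a
geometric bound** (BCD, proof of Prop. 2.20 / Lemma 2.1 on balls; Wang–Zhang 2017, proof of
Lemma 3.2: "`‖u_N‖_{L^p} ≤ C 2^{N(1-3/p)} ‖u‖_{Ḃ^{-1+3/p}_{p,∞}}`"): for a realised `u`,
`‖Ṡ_N u‖_{L^p} ≤ 2 M₀ (1 - 2^s)⁻¹ · 2^{-(N+1)s} ‖u‖_{Ḃ^s_{p,∞}}` (the blocks `j ≤ N + 1` of `Ṡ_N u`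
are bounded by `M₀ 2^{-js} ‖u‖_{Ḃ^s_{p,∞}}`, the others vanish; `ℓ¹`-summation of the blocks,
`eLpNormDistrib_le_tsum_lpBlock`). The bound is stated for every `s`; it is finite only for `s < 0`
(`one_sub_two_rpow_ne_zero`). [cite: WangZhang2016, Lemma 3.2] -/
theorem eLpNormDistrib_lowFreqCutoff_le_of_neg (s : ℝ) (p : ℝ≥0∞) [Fact (1 ≤ p)]
    (N : ℤ) {u : 𝓢'(E, F)} (hu : Tendsto (fun j => lowFreqCutoff j u) atBot (𝓝 0)) :
    eLpNormDistrib p (lowFreqCutoff N u) ≤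
      2 * lowFreqOpNormBound E * (1 - (2 : ℝ≥0∞) ^ s)⁻¹ * (2 : ℝ≥0∞) ^ (-(((N : ℝ) + 1) * s)) *
        eHomBesovNorm s p ∞ u := by
  set r : ℝ≥0∞ := (2 : ℝ≥0∞) ^ s with hr
  set B : ℝ≥0∞ := eHomBesovNorm s p ∞ u with hB
  set K : ℝ≥0∞ := lowFreqOpNormBound E * (2 : ℝ≥0∞) ^ (-(((N : ℝ) + 1) * s)) * B with hK
  -- the termwise bound: `‖Δ̇_j Ṡ_N u‖_{L^p} ≤ K r^{|j - (N+1)|}`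
  have hterm : ∀ j : ℤ, eLpNormDistrib p (lpBlock j (lowFreqCutoff N u)) ≤
      K * r ^ (j - (N + 1)).natAbs := by
    intro j
    by_cases hj : N + 2 ≤ j
    · rw [lpBlock_lowFreqCutoff_eq_zero hj, eLpNormDistrib_zero]
      exact bot_le
    · -- `j ≤ N + 1`: `‖Δ̇_j Ṡ_N u‖ ≤ M₀ ‖Δ̇_j u‖ ≤ M₀ 2^{-js} B = M₀ 2^{-(N+1)s} r^{N+1-j} B`
      have hjle : j ≤ N + 1 := by omega
      have h1 : eLpNormDistrib p (lpBlock j (lowFreqCutoff N u)) ≤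
          lowFreqOpNormBound E * eLpNormDistrib p (lpBlock j u) := by
        rw [lpBlock_lowFreqCutoff_comm]
        exact eLpNormDistrib_lowFreqCutoff_le N _
      have h2 : eLpNormDistrib p (lpBlock j u) ≤ (2 : ℝ≥0∞) ^ (-((j : ℝ) * s)) * B := by
        have hw : lpBlockWeight s p u j ≤ B := by
          rw [hB, eHomBesovNorm_top]
          exact le_iSup (fun j : ℤ => (2 : ℝ≥0∞) ^ ((j : ℝ) * s) * eLpNormDistrib p (lpBlock j u)) j
        calc eLpNormDistrib p (lpBlock j u)
            = (2 : ℝ≥0∞) ^ (-((j : ℝ) * s)) * lpBlockWeight s p u j := by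
              rw [lpBlockWeight, ← mul_assoc, ← ENNReal.rpow_add _ _ two_ne_zero ENNReal.ofNat_ne_top,
                neg_add_cancel, ENNReal.rpow_zero, one_mul]
          _ ≤ (2 : ℝ≥0∞) ^ (-((j : ℝ) * s)) * B := by gcongr
      -- `2^{-js} = 2^{-(N+1)s} · r^{N+1-j}`
      have hnat : (((j - (N + 1)).natAbs : ℕ) : ℝ) = (N : ℝ) + 1 - j := by
        have h : ((j - (N + 1)).natAbs : ℤ) = N + 1 - j := by omega
        have h' : (((j - (N + 1)).natAbs : ℕ) : ℝ) = (((j - (N + 1)).natAbs : ℤ) : ℝ) :=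
          (Int.cast_natCast _).symm
        rw [h', h]
        push_cast
        ring
      have hpow : (2 : ℝ≥0∞) ^ (-((j : ℝ) * s)) =
          (2 : ℝ≥0∞) ^ (-(((N : ℝ) + 1) * s)) * r ^ (j - (N + 1)).natAbs := by
        rw [hr, ← ENNReal.rpow_natCast, ← ENNReal.rpow_mul, hnat,
          ← ENNReal.rpow_add _ _ two_ne_zero ENNReal.ofNat_ne_top]
        congr 1
        ring
      calc eLpNormDistrib p (lpBlock j (lowFreqCutoff N u))
          ≤ lowFreqOpNormBound E * ((2 : ℝ≥0∞) ^ (-((j : ℝ) * s)) * B) := h1.trans (mul_le_mul_right h2 _)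
        _ = K * r ^ (j - (N + 1)).natAbs := by rw [hpow, hK]; ring
  -- summation of the blocks
  have hreal : Tendsto (fun j => lowFreqCutoff j (lowFreqCutoff N u)) atBot (𝓝 0) :=
    tendsto_lowFreqCutoff_lowFreqCutoff_atBot' hu N
  calc eLpNormDistrib p (lowFreqCutoff N u)
      ≤ ∑' j : ℤ, eLpNormDistrib p (lpBlock j (lowFreqCutoff N u)) :=
        eLpNormDistrib_le_tsum_lpBlock _ hreal
    _ ≤ ∑' j : ℤ, K * r ^ (j - (N + 1)).natAbs := ENNReal.tsum_le_tsum hterm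
    _ = K * ∑' j : ℤ, r ^ (j - (N + 1)).natAbs := ENNReal.tsum_mul_left
    _ ≤ K * (2 * (1 - r)⁻¹) := by gcongr; exact tsum_int_pow_natAbs_sub_le r (N + 1)
    _ = 2 * lowFreqOpNormBound E * (1 - (2 : ℝ≥0∞) ^ s)⁻¹ * (2 : ℝ≥0∞) ^ (-(((N : ℝ) + 1) * s)) *
          eHomBesovNorm s p ∞ u := by rw [hK, hr, hB]; ring

/-- `1 - 2^s ≠ 0` in `ℝ≥0∞` for `s < 0`, so the constant of `eLpNormDistrib_lowFreqCutoff_le_of_neg`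
is finite. [folklore] -/
theorem one_sub_two_rpow_ne_zero {s : ℝ} (hs : s < 0) : (1 : ℝ≥0∞) - (2 : ℝ≥0∞) ^ s ≠ 0 := by
  have h : (2 : ℝ≥0∞) ^ s < 1 := ENNReal.rpow_lt_one_of_one_lt_of_neg (by norm_num) hs
  exact (tsub_pos_of_lt h).ne'

/-- **Low frequencies of a realised distribution of finite `Ḃ^s_{p,∞}` norm, `s < 0`, are `L^p`
functions**: `‖Ṡ_N u‖_{L^p} < ∞`. [cite: WangZhang2016, Lemma 3.2] -/
theorem eLpNormDistrib_lowFreqCutoff_lt_top_of_neg {s : ℝ} (hs : s < 0) {p : ℝ≥0∞} [Fact (1 ≤ p)]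
    (N : ℤ) {u : 𝓢'(E, F)} (hu : Tendsto (fun j => lowFreqCutoff j u) atBot (𝓝 0))
    (hB : eHomBesovNorm s p ∞ u < ⊤) : eLpNormDistrib p (lowFreqCutoff N u) < ⊤ := by
  refine (eLpNormDistrib_lowFreqCutoff_le_of_neg s p N hu).trans_lt ?_
  refine ENNReal.mul_lt_top (ENNReal.mul_lt_top (ENNReal.mul_lt_top (ENNReal.mul_lt_top
    (by simp) lowFreqOpNormBound_lt_top) ?_) ?_) hB
  · exact ENNReal.inv_lt_top.2 (pos_iff_ne_zero.2 (one_sub_two_rpow_ne_zero hs))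
  · exact (ENNReal.rpow_ne_top_of_ne_zero two_ne_zero ENNReal.ofNat_ne_top).lt_top

end LowFreqLp

end Literature.Analysis.FunctionSpaces

end
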